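import Mathlib.AlgebraicGeometry.EllipticCurve.NormalForms
import Literature.NumberTheory.EllipticCurves.CanonicalPAdicHeightLeavesProofs
import HarnessLib

/-!
# Admissibility criteria for the sigma formula of the canonical `p`-adic height

Sibling proof file of `CanonicalPAdicHeight.lean` (pure proofs: no definitions, no named facts).
The canonical datum `D` (`PAdicHeightData.IsCanonical`) is pinned by `⟨P, P⟩_D = ĥ_p(P)` on
ADMISSIBLE points `P = (x, y)`: non-torsion, `‖x‖_p > 1`, `z(P)` in the sigma disc, and
`HasNonsingularReductionAt ℓ x y` for every prime `ℓ` (`ord_ℓ x < 0`, or `Φ_x` or `Φ_y` an `ℓ`-adic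
unit). To USE the sigma formula on an explicit point one must verify these coordinate conditions;
this file supplies the criteria (Mazur–Stein–Tate 2006 §1 / Harvey 2008 §2.2 conditions (A1),
(A2): "`P` reduces to `0 ∈ E(𝔽_p)` and to a non-singular point of `E(𝔽_ℓ)` for all bad `ℓ`"):

* `hasNonsingularReductionAt_of_one_lt_norm` / `_of_norm_polynomialX_eq_one` /
  `_of_norm_polynomialY_eq_one` / `_of_norm_y_eq_one` — the three disjuncts in `ℓ`-adic norms
  (`‖x‖_ℓ > 1`; `‖Φ_x‖_ℓ = 1`; `‖Φ_y‖_ℓ = 1`, which for `a₁ = a₃ = 0` and odd `ℓ` is `‖y‖_ℓ = 1`);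
* `hasNonsingularReductionAt_of_norm_Δ_eq_one` — **at a prime `ℓ ∤ 2Δ` EVERY rational point of a
  `ℤ`-integral `y² = x³ + a₂x² + a₄x` reduces non-singularly** (good reduction: `E₀ = E`,
  AEC VII.5.1/VII.2.1), by the resultant identity `U f + V f' = -a₄²(a₂² - 4a₄)`
  (`Δ = 16a₄²(a₂² - 4a₄)`) with integral `U, V`;
* `not_isOfFinAddOrder_of_one_lt_norm` — **`E₁(ℚ_p) ∩ E(ℚ)` is torsion-free for every
  `ℤ`-integral equation**, `p ≥ 3` (the tree's `not_isOfFinAddOrder_of_one_lt_padicNorm_holds`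
  with `IsGloballyMinimal` weakened to `IsIntegral ℤ` — same proof, AEC VII.3.4/IV.6.1);
* `isAdmissible_of_one_lt_norm` — admissibility from `‖x‖_p > 1` and non-singular reduction
  everywhere (`p ≥ 3`);
* `exists_two_nsmul_eq` — the duplication `x`-coordinate `x(2P) = (x² - a₄)²/(2y)²` on
  `y² = x³ + a₂x² + a₄x` (AEC III.2.3(d)), in the form `∃ y' h', 2 • P = (x(2P), y')` for
  Mathlib's group law.

Typical use (Zywina 2025's family `y² = x³ - 5qx² + 4qrx`, `Δ = 2⁸3²mq³r²`): for a point `P` with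
integral coordinates, `2P = ((x²-a₄)²/(2y)², y')`; at `ℓ ∣ 2y·…` dividing the denominator the first
test applies, at good odd `ℓ` the `Δ`-test, and at the three bad primes one checks `‖y'‖_ℓ = 1`;
with `p` dividing the denominator, `2P` is admissible and `⟨2P, 2P⟩_D` is given by the sigma
formula, hence by `log_p(num x(2P))` to first order (`CanonicalPAdicHeightNumeratorProofs.lean`).

## References

* [SilvermanAEC2009] J. H. Silverman, *The Arithmetic of Elliptic Curves*, 2nd ed. (2009):
  III.1 (singular points), III.2.3(d) (duplication formula), VII.2.1–2.2 (`E₀ ⊇ E₁`), VII.3.4 and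
  IV.6.1 (torsion in `E₁`), VII.5.1 (good reduction).
* [MazurSteinTate2006] B. Mazur, W. Stein, J. Tate, Doc. Math. Extra Vol. Coates (2006), §1
  (conditions on `P`).
* [Harvey2008] D. Harvey, LMS J. Comput. Math. 11 (2008), §2.2 ((A1), (A2)).

## Design

`ℓ`-adic norms throughout (the dictionary with `padicValRat` is `one_lt_norm_ratCast_iff`,
`norm_ratCast_eq_one_iff` of `CanonicalPAdicHeightParallelogramProofs.lean`). The good-prime test is
stated for `a₁ = a₃ = a₆ = 0` only (`[W.IsCharNeTwoNF]`, `a₆ = 0`), the shape of `2`-isogeny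
descents; TODO(general form): the general Weierstrass cubic. The doubling lemma is stated over any
field with `[DecidableEq F]` (the instance Mathlib's group law takes), so that over `ℚ` it is the
`2 • P` of `PAdicHeightData.pairing`.
-/

noncomputable section

open scoped Classical NNReal
open Polynomial Literature.NumberTheory.EllipticCurves

namespace WeierstrassCurve

/-! ### Coordinate tests for non-singular reduction -/

section Tests

variable (W : WeierstrassCurve ℚ) (ℓ : ℕ) [Fact ℓ.Prime]

variable {W ℓ} in
/-- `P = (x, y)` with `‖x‖_ℓ > 1` reduces to `Õ`, a non-singular point. [Silverman AEC VII.2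
(definition of `E₁ ⊆ E₀`)] [cite: SilvermanAEC2009, VII.2.1] -/
theorem hasNonsingularReductionAt_of_one_lt_norm {x : ℚ} (y : ℚ) (hx : 1 < ‖(x : ℚ_[ℓ])‖) :
    W.HasNonsingularReductionAt ℓ x y :=
  Or.inl ((one_lt_norm_ratCast_iff ℓ x).mp hx)

variable {W ℓ} in
/-- If `Φ_x(x, y) = a₁y - (3x² + 2a₂x + a₄)` is an `ℓ`-adic unit, `(x, y)` reduces non-singularly
modulo `ℓ`. [Silverman AEC VII.2 (`E₀`), III.1 (singular points: both partials vanish)]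
[cite: SilvermanAEC2009, VII.2.1] -/
theorem hasNonsingularReductionAt_of_norm_polynomialX_eq_one {x y : ℚ}
    (h : ‖((W.toAffine.polynomialX.evalEval x y : ℚ) : ℚ_[ℓ])‖ = 1) :
    W.HasNonsingularReductionAt ℓ x y :=
  Or.inr (Or.inl ((norm_ratCast_eq_one_iff ℓ _).mp h))

variable {W ℓ} in
/-- If `Φ_y(x, y) = 2y + a₁x + a₃` is an `ℓ`-adic unit, `(x, y)` reduces non-singularly modulo `ℓ`.
[Silverman AEC VII.2 (`E₀`), III.1] [cite: SilvermanAEC2009, VII.2.1] -/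
theorem hasNonsingularReductionAt_of_norm_polynomialY_eq_one {x y : ℚ}
    (h : ‖((W.toAffine.polynomialY.evalEval x y : ℚ) : ℚ_[ℓ])‖ = 1) :
    W.HasNonsingularReductionAt ℓ x y :=
  Or.inr (Or.inr ((norm_ratCast_eq_one_iff ℓ _).mp h))

/-- `‖2‖_ℓ = 1` for odd `ℓ`. [folklore] -/
private theorem norm_two_eq_one' (hℓ : ℓ ≠ 2) : ‖(2 : ℚ_[ℓ])‖ = 1 := by
  rw [show (2 : ℚ_[ℓ]) = ((2 : ℕ) : ℚ_[ℓ]) by norm_cast, Padic.norm_natCast_eq_one_iff]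
  exact ((Nat.coprime_primes Nat.prime_two (Fact.out : ℓ.Prime)).mpr (Ne.symm hℓ)).symm

variable {W ℓ} in
/-- For an equation with `a₁ = a₃ = 0` and `ℓ` odd: if `‖y‖_ℓ = 1` then `(x, y)` reduces
non-singularly modulo `ℓ` (`Φ_y = 2y` is a unit). [Silverman AEC VII.2 (`E₀`), III.1]
[cite: SilvermanAEC2009, VII.2.1] -/
theorem hasNonsingularReductionAt_of_norm_y_eq_one [W.IsCharNeTwoNF] (hℓ : ℓ ≠ 2) {x y : ℚ}
    (hy : ‖(y : ℚ_[ℓ])‖ = 1) : W.HasNonsingularReductionAt ℓ x y := by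
  refine hasNonsingularReductionAt_of_norm_polynomialY_eq_one ?_
  rw [WeierstrassCurve.Affine.evalEval_polynomialY, W.a₁_of_isCharNeTwoNF, W.a₃_of_isCharNeTwoNF]
  push_cast
  rw [zero_mul, add_zero, add_zero, norm_mul, norm_two_eq_one' ℓ hℓ, one_mul, hy]

end Tests

/-! ### Good primes: every rational point of `y² = x³ + a₂x² + a₄x` reduces non-singularly -/

section Good

variable {W : WeierstrassCurve ℚ} {ℓ : ℕ} [Fact ℓ.Prime]

/-- The resultant identity for `f = X³ + aX² + bX`: `U·f + V·f' = -b²(a² - 4b)` with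
`U = 4a³ + 6a²X - 15ab - 18bX`, `V = -2a³X - a²b - 2a²X² + 7abX + 4b² + 6bX²` (integer
coefficients). [folklore] -/
private theorem resultant_identity {R : Type*} [CommRing R] (a b x : R) :
    (4 * a ^ 3 + 6 * a ^ 2 * x - 15 * a * b - 18 * b * x) * (x ^ 3 + a * x ^ 2 + b * x) +
      (-2 * a ^ 3 * x - a ^ 2 * b - 2 * a ^ 2 * x ^ 2 + 7 * a * b * x + 4 * b ^ 2 + 6 * b * x ^ 2) *
        (3 * x ^ 2 + 2 * a * x + b) = -(b ^ 2 * (a ^ 2 - 4 * b)) := by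
  ring

/-- **At a prime `ℓ ∤ 2Δ` every rational point reduces non-singularly** (`E₀(ℚ_ℓ) ∩ E(ℚ) = E(ℚ)`:
the reduced curve is non-singular), for a `ℤ`-integral equation `y² = x³ + a₂x² + a₄x`
(`a₁ = a₃ = a₆ = 0`, `Δ = 16a₄²(a₂² - 4a₄)`). Coordinate proof: if `x` is `ℓ`-integral and both
`Φ_x = -f'(x)` and `Φ_y = 2y` were non-units, then `‖f(x)‖ = ‖y‖² < 1` and `‖f'(x)‖ < 1`, so
the resultant identity `U f + V f' = -a₄²(a₂² - 4a₄)` (integral `U, V`) would force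
`‖a₄²(a₂² - 4a₄)‖_ℓ < 1`, i.e. `ℓ ∣ Δ`. [Silverman AEC VII.5.1 (good reduction: `Ẽ` non-singular,
so `E₀ = E`), VII.2.1] [cite: SilvermanAEC2009, VII.2.1]
-- TODO(general form): arbitrary `a₁, a₃, a₆` (resultant of the general Weierstrass cubic). -/
theorem hasNonsingularReductionAt_of_norm_Δ_eq_one [W.IsIntegral ℤ] [W.IsCharNeTwoNF]
    (h6 : W.a₆ = 0) (hℓ : ℓ ≠ 2) (hΔ : ‖(W.Δ : ℚ_[ℓ])‖ = 1) {x y : ℚ}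
    (h : W.toAffine.Nonsingular x y) : W.HasNonsingularReductionAt ℓ x y := by
  by_cases hx : 1 < ‖(x : ℚ_[ℓ])‖
  · exact hasNonsingularReductionAt_of_one_lt_norm y hx
  rw [not_lt] at hx
  -- notation and integrality
  set X : ℚ_[ℓ] := (x : ℚ_[ℓ]) with hXdef
  set Y : ℚ_[ℓ] := (y : ℚ_[ℓ]) with hYdef
  set A : ℚ_[ℓ] := (W.a₂ : ℚ_[ℓ]) with hAdef
  set B : ℚ_[ℓ] := (W.a₄ : ℚ_[ℓ]) with hBdef
  have hA : ‖A‖ ≤ 1 := (mem_localIntegers_iff ℓ _).mp (W.a₂_mem_localIntegers ℓ)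
  have hB : ‖B‖ ≤ 1 := (mem_localIntegers_iff ℓ _).mp (W.a₄_mem_localIntegers ℓ)
  have h2 : ‖(2 : ℚ_[ℓ])‖ = 1 := norm_two_eq_one' ℓ hℓ
  -- the equation `Y² = X³ + A X² + B X`
  have heq : Y ^ 2 = X ^ 3 + A * X ^ 2 + B * X := by
    have e := (WeierstrassCurve.Affine.equation_iff x y).mp h.1
    rw [W.a₁_of_isCharNeTwoNF, W.a₃_of_isCharNeTwoNF, h6] at e
    have e' := congrArg (fun q : ℚ => (q : ℚ_[ℓ])) e
    push_cast at e'
    rw [hYdef, hXdef, hAdef, hBdef]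
    linear_combination e'
  -- `Δ = 16 a₄² (a₂² - 4a₄)`, so `‖a₄²(a₂² - 4a₄)‖ = 1`
  have hdisc : ‖B ^ 2 * (A ^ 2 - 4 * B)‖ = 1 := by
    have hΔ' : (W.Δ : ℚ_[ℓ]) = 16 * (B ^ 2 * (A ^ 2 - 4 * B)) := by
      rw [W.Δ_of_isCharNeTwoNF, h6]; push_cast; rw [hAdef, hBdef]; ring
    have h16 : ‖(16 : ℚ_[ℓ])‖ = 1 := by
      rw [show (16 : ℚ_[ℓ]) = 2 ^ 4 by norm_num, norm_pow, h2, one_pow]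
    rwa [hΔ', norm_mul, h16, one_mul] at hΔ
  -- the two partial derivatives
  have hΦx : (W.toAffine.polynomialX.evalEval x y : ℚ) = -(3 * x ^ 2 + 2 * W.a₂ * x + W.a₄) := by
    rw [WeierstrassCurve.Affine.evalEval_polynomialX, W.a₁_of_isCharNeTwoNF]; ring
  have hΦy : (W.toAffine.polynomialY.evalEval x y : ℚ) = 2 * y := by
    rw [WeierstrassCurve.Affine.evalEval_polynomialY, W.a₁_of_isCharNeTwoNF,
      W.a₃_of_isCharNeTwoNF]; ring
  by_cases hfx : ‖3 * X ^ 2 + 2 * A * X + B‖ = 1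
  · refine hasNonsingularReductionAt_of_norm_polynomialX_eq_one ?_
    rw [hΦx]; push_cast; rw [norm_neg, ← hXdef, ← hAdef, ← hBdef]; exact hfx
  by_cases hyu : ‖Y‖ = 1
  · refine hasNonsingularReductionAt_of_norm_polynomialY_eq_one ?_
    rw [hΦy]; push_cast; rw [norm_mul, h2, one_mul, ← hYdef]; exact hyu
  -- both non-units: contradiction with the resultant identity
  exfalso
  have hfx' : ‖3 * X ^ 2 + 2 * A * X + B‖ < 1 := by
    refine lt_of_le_of_ne ?_ hfx
    have h3 : ‖(3 : ℚ_[ℓ])‖ ≤ 1 := by simpa using norm_natCast_le_one (p := ℓ) 3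
    have h2' : ‖(2 : ℚ_[ℓ])‖ ≤ 1 := h2.le
    refine (IsUltrametricDist.norm_add_le_max _ _).trans (max_le ?_ hB)
    refine (IsUltrametricDist.norm_add_le_max _ _).trans (max_le ?_ ?_)
    · rw [norm_mul, norm_pow]
      exact mul_le_one₀ h3 (pow_nonneg (norm_nonneg _) _) (pow_le_one₀ (norm_nonneg _) hx)
    · rw [norm_mul, norm_mul]
      exact mul_le_one₀ (mul_le_one₀ h2' (norm_nonneg _) hA) (norm_nonneg _) hx
  have hY1 : ‖Y‖ ≤ 1 := by
    have : ‖Y‖ ^ 2 ≤ 1 := by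
      rw [← norm_pow, heq]
      refine (IsUltrametricDist.norm_add_le_max _ _).trans (max_le ?_ ?_)
      · refine (IsUltrametricDist.norm_add_le_max _ _).trans (max_le ?_ ?_)
        · rw [norm_pow]; exact pow_le_one₀ (norm_nonneg _) hx
        · rw [norm_mul, norm_pow]
          exact mul_le_one₀ hA (pow_nonneg (norm_nonneg _) _) (pow_le_one₀ (norm_nonneg _) hx)
      · rw [norm_mul]; exact mul_le_one₀ hB (norm_nonneg _) hx
    nlinarith [norm_nonneg Y]
  have hf' : ‖X ^ 3 + A * X ^ 2 + B * X‖ < 1 := by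
    rw [← heq, norm_pow]
    have hYlt : ‖Y‖ < 1 := lt_of_le_of_ne hY1 hyu
    nlinarith [norm_nonneg Y]
  have hid := resultant_identity A B X
  have nsub : ∀ u v : ℚ_[ℓ], ‖u - v‖ ≤ max ‖u‖ ‖v‖ := fun u v => by
    simpa [sub_eq_add_neg, norm_neg] using IsUltrametricDist.norm_add_le_max u (-v)
  have hU : ‖4 * A ^ 3 + 6 * A ^ 2 * X - 15 * A * B - 18 * B * X‖ ≤ 1 := by
    have hn : ∀ k : ℕ, ‖(k : ℚ_[ℓ])‖ ≤ 1 := fun k => norm_natCast_le_one (p := ℓ) k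
    refine (nsub _ _).trans (max_le ?_ ?_)
    · refine (nsub _ _).trans (max_le ?_ ?_)
      · refine (IsUltrametricDist.norm_add_le_max _ _).trans (max_le ?_ ?_)
        · rw [norm_mul, norm_pow]
          exact mul_le_one₀ (by simpa using hn 4) (pow_nonneg (norm_nonneg _) _)
            (pow_le_one₀ (norm_nonneg _) hA)
        · rw [norm_mul, norm_mul, norm_pow]
          exact mul_le_one₀ (mul_le_one₀ (by simpa using hn 6) (pow_nonneg (norm_nonneg _) _)
            (pow_le_one₀ (norm_nonneg _) hA)) (norm_nonneg _) hx
      · rw [norm_mul, norm_mul]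
        exact mul_le_one₀ (mul_le_one₀ (by simpa using hn 15) (norm_nonneg _) hA) (norm_nonneg _) hB
    · rw [norm_mul, norm_mul]
      exact mul_le_one₀ (mul_le_one₀ (by simpa using hn 18) (norm_nonneg _) hB) (norm_nonneg _) hx
  have hV : ‖-2 * A ^ 3 * X - A ^ 2 * B - 2 * A ^ 2 * X ^ 2 + 7 * A * B * X + 4 * B ^ 2 +
      6 * B * X ^ 2‖ ≤ 1 := by
    have hn : ∀ k : ℕ, ‖(k : ℚ_[ℓ])‖ ≤ 1 := fun k => norm_natCast_le_one (p := ℓ) k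
    have hX2 : ‖X ^ 2‖ ≤ 1 := by rw [norm_pow]; exact pow_le_one₀ (norm_nonneg _) hx
    have hA2 : ‖A ^ 2‖ ≤ 1 := by rw [norm_pow]; exact pow_le_one₀ (norm_nonneg _) hA
    have hA3 : ‖A ^ 3‖ ≤ 1 := by rw [norm_pow]; exact pow_le_one₀ (norm_nonneg _) hA
    have hB2 : ‖B ^ 2‖ ≤ 1 := by rw [norm_pow]; exact pow_le_one₀ (norm_nonneg _) hB
    have m1 : ∀ {u v : ℚ_[ℓ]}, ‖u‖ ≤ 1 → ‖v‖ ≤ 1 → ‖u * v‖ ≤ 1 := fun hu hv => by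
      rw [norm_mul]; exact mul_le_one₀ hu (norm_nonneg _) hv
    refine (IsUltrametricDist.norm_add_le_max _ _).trans (max_le ?_ (m1 (m1 (by simpa using hn 6) hB) hX2))
    refine (IsUltrametricDist.norm_add_le_max _ _).trans (max_le ?_ (m1 (by simpa using hn 4) hB2))
    refine (IsUltrametricDist.norm_add_le_max _ _).trans (max_le ?_ (m1 (m1 (m1 (by simpa using hn 7) hA) hB) hx))
    refine (nsub _ _).trans (max_le ?_ (m1 (m1 (by simpa using hn 2) hA2) hX2))
    refine (nsub _ _).trans (max_le ?_ (m1 hA2 hB))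
    rw [norm_mul, norm_mul, norm_neg]
    exact mul_le_one₀ (mul_le_one₀ (by simpa using hn 2) (norm_nonneg _) hA3) (norm_nonneg _) hx
  have hlt : ‖B ^ 2 * (A ^ 2 - 4 * B)‖ < 1 := by
    rw [← norm_neg, ← hid]
    refine (IsUltrametricDist.norm_add_le_max _ _).trans_lt (max_lt ?_ ?_)
    · rw [norm_mul]
      calc _ ≤ 1 * ‖X ^ 3 + A * X ^ 2 + B * X‖ := by gcongr
        _ < 1 := by rw [one_mul]; exact hf'
    · rw [norm_mul]
      calc _ ≤ 1 * ‖3 * X ^ 2 + 2 * A * X + B‖ := by gcongr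
        _ < 1 := by rw [one_mul]; exact hfx'
  exact absurd hdisc hlt.ne

end Good

/-! ### `E₁(ℚ_p) ∩ E(ℚ)` is torsion-free for every `ℤ`-integral equation (`p` odd) -/

section Torsion

variable {W : WeierstrassCurve ℚ} [W.IsIntegral ℤ] {p : ℕ} [Fact p.Prime]

/-- **A rational point with `‖x‖_p > 1` is non-torsion** (`p ≥ 3`, ANY `ℤ`-integral equation —
not necessarily minimal): `E₁(ℚ_p)` has no torsion. This is the tree's theorem
`not_isOfFinAddOrder_of_one_lt_padicNorm_holds` (`CanonicalPAdicHeightLeavesProofs.lean`) with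
its hypothesis `[W.IsGloballyMinimal]` weakened to `[W.IsIntegral ℤ]`; the proof there (division
polynomials: a multiple of prime order `q` in `E₁` contradicts `val_le_one_of_zsmul_eq_zero` for
`q ≠ p`, and for `q = p` the leading term `p x^{(p²-1)/2}` of `ψ_p` dominates since `‖x‖_p ≥ p²`)
uses integrality only, and is repeated verbatim. [Silverman AEC VII.3.4, IV.6.1]
[cite: SilvermanAEC2009, VII.3.4] -/
theorem not_isOfFinAddOrder_of_one_lt_norm (hp : 3 ≤ p) {x y : ℚ}
    (h : W.toAffine.Nonsingular x y) (hx : 1 < ‖(x : ℚ_[p])‖) :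
    ¬ IsOfFinAddOrder (.some x y h : W.toAffine.Point) := by
  intro hfin
  haveI : W.IsIntegral (ratAdicValuation p).integer := W.isIntegral_integer_ratAdicValuation p
  have hprime : p.Prime := Fact.out
  -- a multiple of prime order, still in `E₁`
  set P : W.toAffine.Point := .some x y h with hPdef
  have hN : 0 < addOrderOf P := hfin.addOrderOf_pos
  have hN1 : addOrderOf P ≠ 1 := by
    rw [Ne, AddMonoid.addOrderOf_eq_one_iff]; exact WeierstrassCurve.Affine.Point.some_ne_zero h
  obtain ⟨q, hq, hqN⟩ := Nat.exists_prime_and_dvd hN1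
  obtain ⟨m, hm⟩ := hqN
  have hm0 : m ≠ 0 := by rintro rfl; rw [mul_zero] at hm; omega
  have hmlt : m < addOrderOf P := by
    rw [hm]; exact lt_mul_left (Nat.pos_of_ne_zero hm0) hq.one_lt
  set R := m • P with hRdef
  have hR0 : R ≠ 0 := nsmul_ne_zero_of_lt_addOrderOf hm0 hmlt
  have hqR : q • R = 0 := by
    rw [hRdef, ← mul_nsmul, Nat.mul_comm m q, ← hm]; exact addOrderOf_nsmul_eq_zero P
  have hRmem : R ∈ W.kernelOfReductionAt p :=
    AddSubgroup.nsmul_mem _ ((some_mem_kernelOfReductionAt_iff h).mpr hx) m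
  rcases hR : R with _ | ⟨x', y', h'⟩
  · exact hR0 hR
  rw [hR] at hRmem hqR
  have hx' : 1 < ‖(x' : ℚ_[p])‖ := (some_mem_kernelOfReductionAt_iff h').mp hRmem
  have hqR' : (q : ℤ) • (.some x' y' h' : W.toAffine.Point) = 0 := by rw [natCast_zsmul]; exact hqR
  -- the same multiple for the classical `DecidableEq ℚ` instance of the generic files
  have hqR'' := (point_zsmul_irrel (instDecidableEqRat) (fun a b => Classical.propDecidable (a = b))
    (q : ℤ) (.some x' y' h' : W.toAffine.Point)).symm.trans hqR'
  by_cases hqp : q = p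
  · -- `q = p`: `ψ_p(x') = 0`, impossible by dominance of `p x'^{(p²-1)/2}`
    subst hqp
    have hΨ : (W.ΨSq q).eval x' = 0 := (W.zsmul_some_eq_zero_iff_eval_ΨSq h' q).mp hqR''
    have hodd : ¬ Even q := fun he => by
      have := hq.even_iff.mp he; omega
    rw [WeierstrassCurve.ΨSq_ofNat, if_neg hodd, mul_one, eval_pow, pow_eq_zero_iff two_ne_zero] at hΨ
    -- integrality, degree and leading coefficient of `preΨ' q`
    set d := (q ^ 2 - 1) / 2 with hd
    have hdeg : (W.preΨ' q).natDegree ≤ d := by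
      have := W.natDegree_preΨ'_le q; rwa [if_neg hodd] at this
    have hlead : (W.preΨ' q).coeff d = q := by
      have := W.coeff_preΨ' q; rw [if_neg hodd, if_neg hodd] at this; exact this
    have hcoeff : ∀ i, ratAdicValuation q ((W.preΨ' q).coeff i) ≤ 1 := fun i => by
      have hmap : W.preΨ' q = ((W.integralModel ℤ).preΨ' q).map (algebraMap ℤ ℚ) := by
        rw [← WeierstrassCurve.map_preΨ', ← WeierstrassCurve.baseChange,
          WeierstrassCurve.baseChange_integralModel_eq]
      rw [hmap, coeff_map, ratAdicValuation_apply, ← NNReal.coe_le_coe, NNReal.coe_one, coe_nnnorm,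
        eq_intCast, Rat.cast_intCast]
      exact Padic.norm_int_le_one _
    have hx1 : 1 ≤ ratAdicValuation q x' := by
      rw [ratAdicValuation_apply, ← NNReal.coe_le_coe, NNReal.coe_one, coe_nnnorm]; exact hx'.le
    have hdom : 1 < ratAdicValuation q ((W.preΨ' q).coeff d) * ratAdicValuation q x' := by
      rw [hlead, ratAdicValuation_apply, ratAdicValuation_apply, ← NNReal.coe_lt_coe, NNReal.coe_one,
        NNReal.coe_mul, coe_nnnorm, coe_nnnorm, Rat.cast_natCast, Padic.norm_p]
      have hp0 : (0 : ℝ) < q := by exact_mod_cast hq.pos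
      have h2q : (2 : ℝ) ≤ q := by exact_mod_cast hq.two_le
      have h2 := sq_le_norm_of_one_lt_norm h' hx'
      rw [inv_mul_eq_div, lt_div_iff₀ hp0, one_mul]
      nlinarith
    have hval := val_eval_eq_mul_pow hcoeff hdeg hx1 hdom
    rw [hΨ, map_zero] at hval
    have hc : 0 < ratAdicValuation q ((W.preΨ' q).coeff d) := by
      refine pos_of_ne_zero fun h0 => ?_
      rw [h0, zero_mul] at hdom
      exact not_lt_of_ge zero_le_one hdom
    exact (mul_pos hc (pow_pos (zero_lt_one.trans_le hx1) d)).ne hval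
  · -- `q ≠ p`: `ΨSq_q` has unit leading coefficient (`val_le_one_of_zsmul_eq_zero`)
    have hwq : ratAdicValuation p ((q : ℤ) : ℚ) = 1 := by
      rw [ratAdicValuation_apply, ← NNReal.coe_eq_one, coe_nnnorm, Int.cast_natCast, Rat.cast_natCast,
        Padic.norm_natCast_eq_one_iff]
      exact (Nat.coprime_primes hprime hq).mpr (Ne.symm hqp)
    have := Literature.NumberTheory.EllipticCurves.val_le_one_of_zsmul_eq_zero (V := W) hwq hqR''
    rw [ratAdicValuation_apply, ← NNReal.coe_le_coe, NNReal.coe_one, coe_nnnorm] at this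
    exact absurd hx' (not_lt.mpr this)

/-- **Admissibility from coordinates** (`ℤ`-integral equation, `p ≥ 3`): a rational point
`P = (x, y)` with `‖x‖_p > 1` which reduces non-singularly at every prime is admissible for the
sigma formula — non-torsion by `not_isOfFinAddOrder_of_one_lt_norm`, in the sigma disc by
`inSigmaDisc_of_one_lt_norm`. These are exactly Mazur–Stein–Tate's conditions on `P`
(reduces to `0 ∈ E(𝔽_p)` and to the connected component at the bad primes; Harvey 2008 §2.2
(A1), (A2)). [Mazur–Stein–Tate 2006, §1; Harvey 2008, §2.2] [cite: MazurSteinTate2006, §1] -/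
theorem isAdmissible_of_one_lt_norm (hp : 3 ≤ p) {x y : ℚ} (h : W.toAffine.Nonsingular x y)
    (hx : 1 < ‖(x : ℚ_[p])‖) (hred : ∀ ℓ : ℕ, ℓ.Prime → W.HasNonsingularReductionAt ℓ x y) :
    W.IsAdmissible p (.some x y h) := by
  have hp2 : p ≠ 2 := by omega
  exact ⟨not_isOfFinAddOrder_of_one_lt_norm hp h hx, hx, (W.inSigmaDisc_of_one_lt_norm hp2 h hx).2,
    hred⟩

end Torsion

/-! ### The duplication `x`-coordinate on `y² = x³ + a₂x² + a₄x` -/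

section Doubling

variable {F : Type*} [Field F] [DecidableEq F] (V : WeierstrassCurve F) [V.IsCharNeTwoNF]

/-- **`x(2P) = (x² - a₄)² / (2y)²`** on `y² = x³ + a₂x² + a₄x` (`a₁ = a₃ = a₆ = 0`), for
`P = (x, y)` with `2y ≠ 0` (the duplication formula `x(2P) = (x⁴ - b₄x² - 2b₆x - b₈)/(4x³ + b₂x²
+ 2b₄x + b₆)` with `b₂ = 4a₂, b₄ = 2a₄, b₆ = 0, b₈ = -a₄²`). [Silverman AEC III.2.3(d)]
[cite: SilvermanAEC2009, III.2.3(d)] -/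
theorem exists_two_nsmul_eq (h6 : V.a₆ = 0) {x y : F} (h : V.toAffine.Nonsingular x y)
    (hy : 2 * y ≠ 0) :
    ∃ (y' : F) (h' : V.toAffine.Nonsingular ((x ^ 2 - V.a₄) ^ 2 / (2 * y) ^ 2) y'),
      (2 : ℕ) • (.some x y h : V.toAffine.Point) = .some ((x ^ 2 - V.a₄) ^ 2 / (2 * y) ^ 2) y' h' := by
  have hy' : y ≠ V.toAffine.negY x y := by
    rw [WeierstrassCurve.Affine.negY, V.a₁_of_isCharNeTwoNF, V.a₃_of_isCharNeTwoNF]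
    intro hyy; apply hy; linear_combination hyy
  have heq : y ^ 2 = x ^ 3 + V.a₂ * x ^ 2 + V.a₄ * x := by
    have e := (WeierstrassCurve.Affine.equation_iff x y).mp h.1
    rw [V.a₁_of_isCharNeTwoNF, V.a₃_of_isCharNeTwoNF, h6] at e
    linear_combination e
  have hslope : V.toAffine.slope x x y y = (3 * x ^ 2 + 2 * V.a₂ * x + V.a₄) / (2 * y) := by
    rw [WeierstrassCurve.Affine.slope_of_Y_ne rfl hy', WeierstrassCurve.Affine.negY,
      V.a₁_of_isCharNeTwoNF, V.a₃_of_isCharNeTwoNF]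
    congr 1 <;> ring
  have key : V.toAffine.addX x x (V.toAffine.slope x x y y) = (x ^ 2 - V.a₄) ^ 2 / (2 * y) ^ 2 := by
    rw [WeierstrassCurve.Affine.addX, hslope, V.a₁_of_isCharNeTwoNF, eq_div_iff (pow_ne_zero 2 hy)]
    have hsq : ((3 * x ^ 2 + 2 * V.a₂ * x + V.a₄) / (2 * y)) ^ 2 * (2 * y) ^ 2 =
        (3 * x ^ 2 + 2 * V.a₂ * x + V.a₄) ^ 2 := by
      rw [div_pow, div_mul_cancel₀ _ (pow_ne_zero 2 hy)]
    linear_combination hsq + (-(4 : F) * (V.a₂ + 2 * x)) * heq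
  refine ⟨V.toAffine.addY x x y (V.toAffine.slope x x y y),
    key ▸ V.toAffine.nonsingular_add h h (fun hxy => hy' hxy.2), ?_⟩
  rw [two_nsmul, WeierstrassCurve.Affine.Point.add_self_of_Y_ne hy']
  congr 1

end Doubling

end WeierstrassCurve

end
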